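/-
Copyright (c) 2026 the pub-hodgecm-mathlib formalisation cell (harness21).  Prover seat hodgecm-mathlib-K2E3-p14 (g7), Track B «K2-LIT» ∕ h413
(`stmt-HodgeConjecture-24833`), line `K2_E3_EllipticInputs`, unit U12 §11, road (11-2-split-nsc) (owner K2E3-p26 (g0)), brick D109 (iii)∕D112: the Borel KMU
push-forward of `GL₂(F)` is absolutely continuous — CLOSED FORM at `N = 2` (port of ★ K2E3-p17 (g7)'s (AC-B) `K2E3GL3BorelKMUAbsCont`).  2026-09-04.
-/
import Summits.HodgeConjecture.HodgeConjecture.Theorems.K2E3GL2BorelKMUDomination          -- (this seat): `borelKMU_null_of_haar_null`, `prod_null_of_lintegral_mul_eq` at `N = 2`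
import Summits.HodgeConjecture.HodgeConjecture.Theorems.K2E3GL2BorelLeviUnipotentCoordinates -- (this seat): `exists_lintegral_torus_unipotent_eq_mul_lintegral_pi` (the Borel (MU) identity at `N = 2`)
import HarnessLib

/-!
# K2_E3 road (h413), §11 (11-2-split-nsc) — brick D109 (iii), closed form: `μ₀(A) = 0 ⇒ (μK ⊗ (νM ⊗ μU)){(k,t,u) | k⁻¹ (t u) k ∈ A} = 0` for the Borel of `GL₂(F)`

Cell `pub/hodgecm-mathlib` (D-0151), Track B, seat K2E3-p14 (g7); dealer K2E3-plan (g4) D112 (13:06:56Z); road K2E3-p26 (g0) census 13:03:37Z (iii)∕(iv): this file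
proves EXACTLY the `(hAC)` binder of ★ (nsc-vD-gen) `K2E3CharLocIntNearParabolicIndOfAC.charLocIntNear_parabolicIndGL_of_ac` at `N = 2`, `c = (id : Fin 2 → Fin 2)`, ∀-closed
over `F` with `[CharZero F]` (for `2 ≠ 0`, the input of ★ `K2E3GL2BorelSliceKIntegral.lintegral_glInt_sliceFunctional_eq`): `hMU` of `borelKMU_null_of_haar_null` is
discharged by the (MU) identity through the rider `prod_null_of_lintegral_mul_eq`; the auxiliary additive Haar measure of `F` and the Borel structure on `F` are chosen
inside.  `--supports stmt-HodgeConjecture-24833 --as helper`; THEOREMS ONLY; never imports `Cruxes/…/Lines`.  COUNT-NEUTRAL.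
[vanDijk1972, Thm. p. 237] [BernsteinZelevinsky1977, §2.3] [HarishChandra1970, Part V §4 Lemma 22] [WeilBNT1967, Ch. II §5]
HONEST LABEL: HC_CM is proved only modulo the 7 printed citations (2 remaining named inputs: hLiu418 = stmt-HodgeConjecture-24832, h413 = stmt-HodgeConjecture-24833)
until rung 0 closes; count-neutral helper (the (AC) input of ★ (nsc-vD-gen) for the principal series of `GL₂`; consumer: K2E3-p26 (g0)'s payer (iv)).

## References
* [vanDijk1972] G. van Dijk, *Computation of certain induced characters of 𝔭-adic groups*, Math. Ann. 199 (1972), 229–240.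
* [BernsteinZelevinsky1977] I. N. Bernstein, A. V. Zelevinsky, *Induced representations of reductive 𝔭-adic groups I*, Ann. Sci. ÉNS 10 (1977), §2.3.
* [HarishChandra1970] Harish-Chandra (van Dijk), *Harmonic Analysis on Reductive p-adic Groups*, LNM 162 (1970), Part V §4.
* [WeilBNT1967] A. Weil, *Basic Number Theory* (1967), Ch. II §5.
-/

set_option autoImplicit false
set_option linter.dupNamespace false

noncomputable section

open MeasureTheory MeasureTheory.Measure Set Topology
open scoped NNReal ENNReal MatrixGroups
open Literature.NumberTheory.GaloisRepresentations Literature.NumberTheory.GaloisRepresentations.IsNonarchimedeanLocalField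
open Literature.NumberTheory.Automorphic
open Summit.HodgeConjecture.HodgeConjecture.Cruxes.H413.K2E3GL2BorelKMUDomination

namespace Summit.HodgeConjecture.HodgeConjecture.Cruxes.H413.K2E3GL2BorelKMUAbsCont

/-- **(AC-B) AT `N = 2`: THE BOREL KMU PUSH-FORWARD OF `μK ⊗ (νM ⊗ μU)` UNDER `(k, t, u) ↦ k⁻¹ (t u) k` IS ABSOLUTELY CONTINUOUS W.R.T. HAAR MEASURE OF `GL₂(F)`** — the
`(hAC)` binder of ★ `charLocIntNear_parabolicIndGL_of_ac` at `N = 2`, `c = id` (★-shape of (AC-B) with `3 ↦ 2`, `[CharZero F]`).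
[cite: HarishChandra1970, Part V §4 Lemma 22] [cite: vanDijk1972, Thm. p. 237] [cite: WeilBNT1967, Ch. II §5] -/
theorem borelKMU_absolutelyContinuous_two :
    ∀ (F : Type) [Field F] [CharZero F] [ValuativeRel F] [TopologicalSpace F] [IsNonarchimedeanLocalField F]
      [MeasurableSpace (GL (Fin 2) F)] [BorelSpace (GL (Fin 2) F)] (μ₀ : Measure (GL (Fin 2) F)) [μ₀.IsHaarMeasure]
      (νM : Measure ↥(standardLeviGL F (id : Fin 2 → Fin 2))) [νM.IsHaarMeasure]
      (μU : Measure ↥(unipotentRadicalGL F (id : Fin 2 → Fin 2))) [μU.IsHaarMeasure]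
      (μK : Measure ↥(glInt 2 F)) [μK.IsHaarMeasure] (A : Set (GL (Fin 2) F)), MeasurableSet A → μ₀ A = 0 →
      (μK.prod (νM.prod μU)) {t : ↥(glInt 2 F) × (↥(standardLeviGL F (id : Fin 2 → Fin 2)) × ↥(unipotentRadicalGL F (id : Fin 2 → Fin 2))) |
        ((t.1 : GL (Fin 2) F))⁻¹ * ((t.2.1 : GL (Fin 2) F) * (t.2.2 : GL (Fin 2) F)) * (t.1 : GL (Fin 2) F) ∈ A} = 0 := by
  intro F _ _ _ _ _ _ _ μ₀ _ νM _ μU _ μK _ A hA hA0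
  haveI : T2Space F := (isLocalField F).toT2Space
  haveI : LocallyCompactSpace F := (isLocalField F).toLocallyCompactSpace
  haveI : SecondCountableTopology F := secondCountableTopology_localField F
  haveI : IsTopologicalRing F := inferInstance
  letI : MeasurableSpace F := borel F
  haveI : BorelSpace F := ⟨rfl⟩
  letI : MeasurableSpace (Matrix (Fin 2) (Fin 2) F) := borel _
  haveI : BorelSpace (Matrix (Fin 2) (Fin 2) F) := ⟨rfl⟩
  haveI : T2Space (GL (Fin 2) F) := t2Space_generalLinearGroup F 2
  haveI : SecondCountableTopology (Matrix (Fin 2) (Fin 2) F) := inferInstanceAs (SecondCountableTopology (Fin 2 → Fin 2 → F))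
  haveI : SecondCountableTopology (Matrix (Fin 2) (Fin 2) F)ᵐᵒᵖ := MulOpposite.opHomeomorph.symm.secondCountableTopology
  haveI : SecondCountableTopology (GL (Fin 2) F) := Units.isEmbedding_embedProduct.secondCountableTopology
  haveI : LocallyCompactSpace (GL (Fin 2) F) := locallyCompactSpace_generalLinearGroup F 2
  haveI : SecondCountableTopology ↥(standardLeviGL F (id : Fin 2 → Fin 2)) := TopologicalSpace.Subtype.secondCountableTopology _
  haveI : SecondCountableTopology ↥(unipotentRadicalGL F (id : Fin 2 → Fin 2)) := TopologicalSpace.Subtype.secondCountableTopology _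
  haveI : BorelSpace ↥(standardLeviGL F (id : Fin 2 → Fin 2)) := Subtype.borelSpace _
  haveI : BorelSpace ↥(unipotentRadicalGL F (id : Fin 2 → Fin 2)) := Subtype.borelSpace _
  haveI : LocallyCompactSpace ↥(unipotentRadicalGL F (id : Fin 2 → Fin 2)) := (isClosed_unipotentRadicalGL (R := F) (id : Fin 2 → Fin 2)).locallyCompactSpace
  haveI : LocallyCompactSpace ↥(standardLeviGL F (id : Fin 2 → Fin 2)) := (isClosed_standardLeviGL (R := F) (id : Fin 2 → Fin 2)).locallyCompactSpace
  haveI : SFinite μU := inferInstance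
  set dx : Measure F := Measure.addHaar with hdx
  -- (MU) ⇒ `hMU`
  obtain ⟨c, -, -, hc⟩ := K2E3GL2BorelLeviUnipotentCoordinates.exists_lintegral_torus_unipotent_eq_mul_lintegral_pi νM μU dx
  exact borelKMU_null_of_haar_null two_ne_zero μK νM μU dx (fun E hE hE0 => prod_null_of_lintegral_mul_eq νM μU dx hc hE hE0) μ₀ hA hA0

end Summit.HodgeConjecture.HodgeConjecture.Cruxes.H413.K2E3GL2BorelKMUAbsCont

end
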